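import Summits.RiemannHypothesis.RiemannHypothesis.Theses.WeilComb
import Summits.RiemannHypothesis.RiemannHypothesis.Theorems.WeilCombCombSubcriticalStubIdentity
import Mathlib.NumberTheory.ArithmeticFunction.VonMangoldt
import Mathlib.Analysis.InnerProductSpace.Basic

/-!
# Perron-pivot (Temple) reduction for Theorem B on the band — stub `stub_windowCore` of line `Sketch`
(crux `WeilComb.CombShapePositivity`, item stmt-RiemannHypothesis-11229; siege k8, variation
"interval certificate for the finite window range + analytic tail")

On the exact window `2ε(M+1) ≤ 1` the comb form is, per unit `U = ε⁻¹‖φ₀‖₂²`, the Hermitian form of the real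
symmetric matrix `K/U = Pole/U − S + Arch/U` (`weilQuadratic_comb_re_exactWindow_explicit`). Numerically
(siege k8, kit j018508/j018572 and `work/local/mini*.py`) its bottom eigenvalue on the band `1/40 < εM ≤ M/(2(M+1))`
tracks the Λ-free Perron asymptote `m∞(λ) = Rλ + log(1/λ) + γ − c_d` (`R = I₀²/‖φ₀‖₂² = 1.4812`, `c_d = 1.9555`),
minimal at the top of the band: `m∞(1/2) = R/2 − log 2π − ∫₀²(ψ₀(τ)/ψ₀(0) − 1)dτ/τ = 0.0555`.
The Perron ray `u_m = m^{-1/2}` is an approximate ground state with residual `‖Kû − μû‖² ≈ 0.05/H_M` and the form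
restricted to `û^⊥` is coercive (`≈ 0.5` at the top of the band), so TEMPLE'S INEQUALITY
`λ_min ≥ μ − ‖r‖²/(κ − μ)` is positive (`0.042` at `M = 40`, `→ m∞` as `M → ∞`). This file lands the two
estimate-free bricks of that architecture:

* `temple_inner` — Temple / Schur-complement inequality for a symmetric linear map on a complex inner product
  space: pivot `u` (‖u‖ = 1), `μ = Re⟪Ku,u⟫`, residual `r = Ku − μu`, coercivity `κ > μ` on `u^⊥` ⟹
  `Re⟪Ka,a⟫ ≥ (μ − ‖r‖²/(κ − μ))‖a‖²`; scalar core `temple_scalar`.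
* the Λ-FREE evaluation of the arithmetic side at the Perron ray (census F2, made formal): the Dirichlet energy of
  `u` vanishes (`perron_dirichletEnergy_eq_zero`), the Helson potential and the Helson form both equal
  `2 Σ_{k ≤ M} log k / k` (`perron_potential_eq`, `perron_helson_eq`, via the ground-state identity `stub_identity`),
  `‖u‖² = H_M` and the two polar sums are `H_M` and `M` (`perron_normSq_sum`, `perron_polarSums`).

What remains for `stub_windowCore` along this line (recorded in the siege-k8 evidence memo): certified bump
constants (`R`, `c_d`, the Stieltjes smoothing of `ψ₀`) to ≈1 %, an explicit two-sided Mertens bound for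
`ψ₁(y) − log y + γ`, and the coercivity lemma `K|_{û^⊥} ⪰ κ₀ ≈ 0.25·U` (true value ≈ 0.5·U), uniformly in `M`.
-/

noncomputable section

-- the sub-problem path `RiemannHypothesis/RiemannHypothesis` (single-conjunct summit, D-0017) duplicates a namespace
set_option linter.dupNamespace false

open scoped BigOperators ComplexConjugate InnerProductSpace
open Complex

namespace Summit.RiemannHypothesis.RiemannHypothesis.Theorems.WeilCombBohrFejer

/-! ## Temple's inequality (Schur complement on a pivot) -/

/-- Scalar core of Temple's inequality: for `μ < κ`, `0 ≤ ρ`,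
`(μ − ρ²/(κ − μ))(c² + t²) ≤ μc² − 2ρct + κt²` (complete the square after multiplying by `κ − μ`). [folklore] -/
theorem temple_scalar {μ κ ρ c t : ℝ} (hκ : μ < κ) :
    (μ - ρ ^ 2 / (κ - μ)) * (c ^ 2 + t ^ 2) ≤ μ * c ^ 2 - 2 * ρ * c * t + κ * t ^ 2 := by
  have hd : 0 < κ - μ := sub_pos.2 hκ
  have key : 0 ≤ (ρ * c - (κ - μ) * t) ^ 2 + ρ ^ 2 * t ^ 2 := by positivity
  rw [show μ - ρ ^ 2 / (κ - μ) = (μ * (κ - μ) - ρ ^ 2) / (κ - μ) by field_simp, div_mul_eq_mul_div,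
    div_le_iff₀ hd]
  nlinarith [key]

variable {V : Type*} [NormedAddCommGroup V] [InnerProductSpace ℂ V]

/-- **Temple's inequality / pivot Schur complement.** Let `K` be a symmetric linear map of a complex inner product
space, `u` a unit vector ("pivot"), `μ = Re⟪Ku,u⟫` its Rayleigh quotient, `r = Ku − μu` its residual, and suppose
`K` is coercive with constant `κ > μ` on the orthogonal complement of `u`. Then
`Re⟪Ka,a⟫ ≥ (μ − ‖r‖²/(κ − μ))‖a‖²` for every `a`.
(Temple 1928; here in the Schur-complement form: decompose `a = ⟪u,a⟫u + h`, `h ⊥ u`; the cross term is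
`2 Re(conj⟪u,a⟫ ⟪r,h⟫)` because `⟪Ku,h⟫ = ⟪r,h⟫`, and `|⟪r,h⟫| ≤ ‖r‖‖h‖`; G. Temple, Proc. R. Soc. A 119 (1928).) [folklore] -/
theorem temple_inner (K : V →ₗ[ℂ] V) (hK : ∀ x y : V, ⟪K x, y⟫_ℂ = ⟪x, K y⟫_ℂ) (u : V) (hu : ‖u‖ = 1)
    {μ κ : ℝ} (hμ : (⟪K u, u⟫_ℂ).re = μ) (hκ : μ < κ)
    (hcoer : ∀ h : V, ⟪u, h⟫_ℂ = 0 → κ * ‖h‖ ^ 2 ≤ (⟪K h, h⟫_ℂ).re) (a : V) :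
    (μ - ‖K u - (μ : ℂ) • u‖ ^ 2 / (κ - μ)) * ‖a‖ ^ 2 ≤ (⟪K a, a⟫_ℂ).re := by
  set c : ℂ := ⟪u, a⟫_ℂ with hc
  set h : V := a - c • u with hh
  set r : V := K u - (μ : ℂ) • u with hr
  have huu : ⟪u, u⟫_ℂ = 1 := by
    rw [inner_self_eq_norm_sq_to_K, hu]; simp
  -- `⟪Ku, u⟫` is real, equal to `μ`
  have hKuu : ⟪K u, u⟫_ℂ = (μ : ℂ) := by
    have hreal : conj ⟪K u, u⟫_ℂ = ⟪K u, u⟫_ℂ := by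
      rw [inner_conj_symm, ← hK]
    apply Complex.ext
    · simp [hμ]
    · have := congrArg Complex.im hreal
      simp only [Complex.conj_im] at this
      simp only [Complex.ofReal_im]
      linarith
  have huKu : ⟪u, K u⟫_ℂ = (μ : ℂ) := by rw [← hK, hKuu]
  -- orthogonality relations
  have huh : ⟪u, h⟫_ℂ = 0 := by
    rw [hh, inner_sub_right, inner_smul_right, huu, mul_one, hc, sub_self]
  have hur : ⟪u, r⟫_ℂ = 0 := by
    rw [hr, inner_sub_right, inner_smul_right, huKu, huu, mul_one, sub_self]
  have hrh : ⟪K u, h⟫_ℂ = ⟪r, h⟫_ℂ := by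
    have : K u = r + (μ : ℂ) • u := by rw [hr]; abel
    rw [this, inner_add_left, inner_smul_left, huh, mul_zero, add_zero]
  have hhKu : ⟪K h, u⟫_ℂ = conj ⟪r, h⟫_ℂ := by
    rw [hK, ← inner_conj_symm, hrh]
  -- decomposition of `a` and Pythagoras
  have ha : a = c • u + h := by rw [hh]; abel
  have hnorm : ‖a‖ ^ 2 = ‖c‖ ^ 2 + ‖h‖ ^ 2 := by
    have horth : ⟪c • u, h⟫_ℂ = 0 := by rw [inner_smul_left, huh, mul_zero]
    have h1 := norm_add_sq_eq_norm_sq_add_norm_sq_of_inner_eq_zero (c • u) h horth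
    rw [← ha, norm_smul, hu, mul_one] at h1
    rw [sq, sq, sq]
    exact h1
  -- expansion of the form
  have hform : (⟪K a, a⟫_ℂ).re = μ * ‖c‖ ^ 2 + 2 * (conj c * ⟪r, h⟫_ℂ).re + (⟪K h, h⟫_ℂ).re := by
    have e : ⟪K a, a⟫_ℂ = conj c * c * ⟪K u, u⟫_ℂ + conj c * ⟪K u, h⟫_ℂ + c * ⟪K h, u⟫_ℂ + ⟪K h, h⟫_ℂ := by
      rw [ha, map_add, map_smul, inner_add_left, inner_add_right, inner_add_right, inner_smul_left,
        inner_smul_left, inner_smul_right, inner_smul_right]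
      ring
    rw [e, hKuu, hrh, hhKu]
    have e2 : conj c * c = ((‖c‖ ^ 2 : ℝ) : ℂ) := by
      rw [mul_comm, Complex.mul_conj, Complex.normSq_eq_norm_sq]
    rw [e2]
    simp only [Complex.add_re, Complex.mul_re, Complex.ofReal_re, Complex.ofReal_im, zero_mul, sub_zero,
      Complex.conj_re, Complex.conj_im]
    ring
  -- Cauchy–Schwarz on the cross term and coercivity on `h`
  have hcross : -(2 * ‖r‖ * ‖c‖ * ‖h‖) ≤ 2 * (conj c * ⟪r, h⟫_ℂ).re := by
    have h1 : |(conj c * ⟪r, h⟫_ℂ).re| ≤ ‖conj c * ⟪r, h⟫_ℂ‖ := Complex.abs_re_le_norm _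
    have h2 : ‖conj c * ⟪r, h⟫_ℂ‖ ≤ ‖c‖ * (‖r‖ * ‖h‖) := by
      rw [norm_mul, Complex.norm_conj]
      exact mul_le_mul_of_nonneg_left (norm_inner_le_norm r h) (norm_nonneg _)
    have h3 := neg_abs_le (conj c * ⟪r, h⟫_ℂ).re
    nlinarith
  have hcoh : κ * ‖h‖ ^ 2 ≤ (⟪K h, h⟫_ℂ).re := hcoer h huh
  have hT := temple_scalar (ρ := ‖r‖) (c := ‖c‖) (t := ‖h‖) hκ
  rw [hnorm, hform]
  linarith

/-! ## The Perron ray: Λ-free evaluation of the arithmetic side -/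

/-- Reindexing the divisor graph by its endpoint: `Σ_{m ≤ M} Σ_{n ≤ M/m} Λ(n) f(nm) = Σ_{k ≤ M} f(k) log k`
(`k = nm`, `Σ_{n ∣ k} Λ(n) = log k`). [folklore] -/
theorem sum_Icc_sum_vonMangoldt_mul_apply (M : ℕ) (f : ℕ → ℝ) :
    ∑ m ∈ Finset.Icc 1 M, ∑ n ∈ Finset.Icc 1 (M / m),
        (ArithmeticFunction.vonMangoldt n : ℝ) * f (n * m) =
      ∑ k ∈ Finset.Icc 1 M, f k * Real.log k := by
  -- adapted from the (private) `sum_vonMangoldt_norm_sq_eq` of `WeilCombCombSubcriticalStubIdentity`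
  simp_rw [← ArithmeticFunction.vonMangoldt_sum, Finset.mul_sum]
  rw [Finset.sum_sigma', Finset.sum_sigma']
  refine Finset.sum_nbij' (fun x => ⟨x.2 * x.1, x.2⟩) (fun y => ⟨y.1 / y.2, y.2⟩) ?_ ?_ ?_ ?_ ?_
  · rintro ⟨m, n⟩ hx
    simp only [Finset.mem_sigma, Finset.mem_Icc] at hx
    obtain ⟨⟨hm1, -⟩, hn1, hnM⟩ := hx
    have hnm : 0 < n * m := Nat.mul_pos hn1 hm1
    simp only [Finset.mem_sigma, Finset.mem_Icc, Nat.mem_divisors]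
    exact ⟨⟨hnm, (Nat.le_div_iff_mul_le hm1).1 hnM⟩, dvd_mul_right n m, hnm.ne'⟩
  · rintro ⟨k, n⟩ hy
    simp only [Finset.mem_sigma, Finset.mem_Icc, Nat.mem_divisors] at hy
    obtain ⟨⟨hk1, hkM⟩, hnk, -⟩ := hy
    have hn0 : 0 < n := Nat.pos_of_dvd_of_pos hnk hk1
    have hkn : 0 < k / n := Nat.div_pos (Nat.le_of_dvd hk1 hnk) hn0
    simp only [Finset.mem_sigma, Finset.mem_Icc]
    refine ⟨⟨hkn, (Nat.div_le_self k n).trans hkM⟩, hn0, (Nat.le_div_iff_mul_le hkn).2 ?_⟩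
    rw [Nat.mul_div_cancel' hnk]
    exact hkM
  · rintro ⟨m, n⟩ hx
    simp only [Finset.mem_sigma, Finset.mem_Icc] at hx
    simp only [Nat.mul_div_cancel_left m hx.2.1]
  · rintro ⟨k, n⟩ hy
    simp only [Finset.mem_sigma, Nat.mem_divisors] at hy
    simp only [Nat.mul_div_cancel' hy.2.1]
  · rintro ⟨m, n⟩ -
    exact mul_comm _ _

/-- The Perron ray `u_k = k^{-1/2}` (as a complex sequence). -/
private theorem perron_apply_mul (n m : ℕ) :
    ((Real.sqrt ((n * m : ℕ) : ℝ) : ℝ) : ℂ)⁻¹ = ((Real.sqrt n : ℂ))⁻¹ * ((Real.sqrt (m : ℝ) : ℝ) : ℂ)⁻¹ := by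
  rw [Nat.cast_mul, Real.sqrt_mul (Nat.cast_nonneg n)]
  push_cast
  rw [mul_inv]

/-- `‖u_m‖² = 1/m` (also at `m = 0`, where both sides vanish in Lean). -/
private theorem perron_normSq (m : ℕ) : ‖((Real.sqrt (m : ℝ) : ℝ) : ℂ)⁻¹‖ ^ 2 = 1 / m := by
  have hm0 : (0 : ℝ) ≤ m := Nat.cast_nonneg m
  rw [norm_inv, Complex.norm_real, Real.norm_eq_abs, abs_of_nonneg (Real.sqrt_nonneg _), inv_pow,
    Real.sq_sqrt hm0, one_div]

/-- **The Perron ray is the ground state of the Dirichlet energy**: every edge term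
`u(nm) − n^{-1/2} u(m)` vanishes, so `D(u) = 0`. [folklore] -/
theorem perron_dirichletEnergy_eq_zero (M : ℕ) :
    ∑ m ∈ Finset.Icc 1 M, ∑ n ∈ Finset.Icc 1 (M / m),
        (ArithmeticFunction.vonMangoldt n : ℝ) *
          ‖(fun k : ℕ => ((Real.sqrt (k : ℝ) : ℝ) : ℂ)⁻¹) (n * m) -
              ((Real.sqrt n : ℂ))⁻¹ * (fun k : ℕ => ((Real.sqrt (k : ℝ) : ℝ) : ℂ)⁻¹) m‖ ^ 2 = 0 := by
  refine Finset.sum_eq_zero fun m _ => Finset.sum_eq_zero fun n _ => ?_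
  simp only [perron_apply_mul, sub_self, norm_zero]
  ring

/-- **Helson potential at the Perron ray** (Λ-free): `Σ_m ‖u_m‖² (log m + ψ₁(M/m)) = 2 Σ_{k ≤ M} log k / k`,
because `Σ_m m⁻¹ ψ₁(M/m) = Σ_{k ≤ M} log k / k` by `Σ_{n ∣ k} Λ(n) = log k`. [folklore] -/
theorem perron_potential_eq (M : ℕ) :
    ∑ m ∈ Finset.Icc 1 M, ‖((Real.sqrt (m : ℝ) : ℝ) : ℂ)⁻¹‖ ^ 2 *
        (Real.log m + ∑ n ∈ Finset.Icc 1 (M / m), (ArithmeticFunction.vonMangoldt n : ℝ) / n) =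
      2 * ∑ k ∈ Finset.Icc 1 M, Real.log k / k := by
  have h1 : ∀ m ∈ Finset.Icc 1 M, ‖((Real.sqrt (m : ℝ) : ℝ) : ℂ)⁻¹‖ ^ 2 *
      (Real.log m + ∑ n ∈ Finset.Icc 1 (M / m), (ArithmeticFunction.vonMangoldt n : ℝ) / n) =
      Real.log m / m + ∑ n ∈ Finset.Icc 1 (M / m),
        (ArithmeticFunction.vonMangoldt n : ℝ) * (1 / ((n * m : ℕ) : ℝ)) := by
    intro m _
    rw [perron_normSq m, mul_add, Finset.mul_sum]
    congr 1
    · ring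
    · refine Finset.sum_congr rfl fun n _ => ?_
      push_cast
      ring
  rw [Finset.sum_congr rfl h1, Finset.sum_add_distrib,
    sum_Icc_sum_vonMangoldt_mul_apply M (fun k => 1 / (k : ℝ)), two_mul]
  congr 1
  refine Finset.sum_congr rfl fun k _ => ?_
  ring

/-- **Helson form at the Perron ray** (Λ-free; census F2 made formal):
`2 Re Σ_m Σ_{n ≤ M/m} Λ(n) n^{-1/2} u(nm) conj u(m) = 2 Σ_{k ≤ M} log k / k` — the ground-state identity
`H = V − D` (`stub_identity`) with `D(u) = 0`. Asymptotically `(1/H_M)·2Σ_{k≤M} log k/k = log M − γ + O(1/log M)`: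
the Helson form spends exactly the `log M` of the archimedean diagonal on the Perron ray. [folklore] -/
theorem perron_helson_eq : ∀ M : ℕ,
    2 * (∑ m ∈ Finset.Icc 1 M, ∑ n ∈ Finset.Icc 1 (M / m),
        ((ArithmeticFunction.vonMangoldt n : ℝ) : ℂ) / (Real.sqrt n : ℂ) *
          ((Real.sqrt ((n * m : ℕ) : ℝ) : ℝ) : ℂ)⁻¹ * conj (((Real.sqrt (m : ℝ) : ℝ) : ℂ)⁻¹)).re =
      2 * ∑ k ∈ Finset.Icc 1 M, Real.log k / k := by
  intro M
  have h := Summit.RiemannHypothesis.RiemannHypothesis.Theorems.WeilCombSubcritical.stub_identity M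
    (fun k : ℕ => ((Real.sqrt (k : ℝ) : ℝ) : ℂ)⁻¹)
  rw [perron_dirichletEnergy_eq_zero, sub_zero, perron_potential_eq] at h
  exact h

/-- `‖u‖² = H_M = Σ_{m ≤ M} 1/m` on the Perron ray. [folklore] -/
theorem perron_normSq_sum (M : ℕ) :
    ∑ m ∈ Finset.Icc 1 M, ‖((Real.sqrt (m : ℝ) : ℝ) : ℂ)⁻¹‖ ^ 2 = ∑ m ∈ Finset.Icc 1 M, (1 : ℝ) / m :=
  Finset.sum_congr rfl fun m _ => perron_normSq m

/-- The two polar sums at the Perron ray: `A₋(u) = Σ u_m m^{-1/2} = H_M` and `A₊(u) = Σ u_m m^{1/2} = M`, so the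
pole contributes `2F_ε² · H_M · M`, i.e. `2(F_ε²ε/‖φ₀‖₂²)·(εM)⁻¹… = 2Rλ` per unit `U‖u‖²`. [folklore] -/
theorem perron_polarSums (M : ℕ) :
    ∑ m ∈ Finset.Icc 1 M, ((Real.sqrt (m : ℝ) : ℝ) : ℂ)⁻¹ * ((Real.sqrt (m : ℝ) : ℝ) : ℂ)⁻¹ =
        ((∑ m ∈ Finset.Icc 1 M, (1 : ℝ) / m : ℝ) : ℂ) ∧
      ∑ m ∈ Finset.Icc 1 M, ((Real.sqrt (m : ℝ) : ℝ) : ℂ)⁻¹ * ((Real.sqrt (m : ℝ) : ℝ) : ℂ) = (M : ℂ) := by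
  constructor
  · push_cast
    refine Finset.sum_congr rfl fun m hm => ?_
    have hm0 : (0 : ℝ) ≤ m := Nat.cast_nonneg m
    rw [← mul_inv, ← Complex.ofReal_mul, Real.mul_self_sqrt hm0]
    push_cast
    ring
  · have h1 : ∀ m ∈ Finset.Icc 1 M, ((Real.sqrt (m : ℝ) : ℝ) : ℂ)⁻¹ * ((Real.sqrt (m : ℝ) : ℝ) : ℂ) = 1 := by
      intro m hm
      have hm1 : (0 : ℝ) < m := by exact_mod_cast (Finset.mem_Icc.1 hm).1
      have hs : ((Real.sqrt (m : ℝ) : ℝ) : ℂ) ≠ 0 := by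
        exact_mod_cast (Real.sqrt_pos.2 hm1).ne'
      exact inv_mul_cancel₀ hs
    rw [Finset.sum_congr rfl h1, Finset.sum_const, Nat.card_Icc, Nat.add_sub_cancel]
    simp

end Summit.RiemannHypothesis.RiemannHypothesis.Theorems.WeilCombBohrFejer

end
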